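import Mathlib
import Literature.Algebra.Polynomial.ErdosTuranPositiveZeros
import HarnessLib

/-!
# Erdős–Turán (1950), positive zeros — the real-coefficient form and the consumer's corollary, PROVED from the named fact

Sibling (proof lane) of `ErdosTuranPositiveZeros.lean`, which vendors the named fact
`Literature.Algebra.Polynomial.ErdosTuran1950_positiveZeros` («Theorem 5.1. If `P(z)`, given by (5.1), has `p` positive
zeros, then `p² ≤ 2 n log R`», `R = (|a₀| + ⋯ + |aₙ|)/√|a₀ aₙ|`, complex coefficients, [MilovanovicRassias2000] §5 =
[ErdosTuran1950]).  Here, all PROVED: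
* `one_le_l1_div_sqrt` — `R ≥ 1` (so `log R ≥ 0`) for a real polynomial with `a₀ ≠ 0`: `√|a₀ aₙ| ≤ Σ |aₖ|`;
* `ErdosTuran1950_positiveZeros.real` — the real-coefficient form: for `q : ℝ[X]`, `q(0) ≠ 0`, the positive roots counted with
  multiplicity satisfy `p² ≤ 2 n log(Σ|aₖ| / √|a₀ aₙ|)` (transfer along `q.map Complex.ofReal`: the real positive roots embed
  into the roots of the complexification on the positive real axis, `Polynomial.map_roots_le`; coefficient norms agree);
* `ErdosTuran1950_positiveZeros.positiveAxis` — for every `h : ErdosTuran1950_positiveZeros`, the weaker form consumed by the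
  Valiant summit's helper `Summit.ValiantsHypothesis.ValiantsHypothesis.Theorems.LacunarySymmetroidMatrixDescartes.RangeObligations.
  violator_degree` (p607620): its explicit binder `hET` TOKEN-FOR-TOKEN with `l1 q` unfolded (checked in scratch: `violator_degree
  h.positiveAxis d S hS hends` elaborates), i.e. DISTINCT positive roots `Z₊` and the constant `256 = 16²` of the angular
  discrepancy theorem (survey Theorem 5.3): `Z₊ ≤ p`, `2 ≤ 256`, `log R ≥ 0`.
Honest framing: Literature layer; the fact itself stays OPEN (typed, not discharged); nothing here bears on the crux
`MatrixDescartes` (stmt-ValiantsHypothesis-18050) or on `VP ≠ VNP` (NOT proved).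
-/

noncomputable section

open Polynomial

namespace Literature.Algebra.Polynomial

/-- `R ≥ 1` for the printed quantity (5.3) `R = (|a₀| + ⋯ + |aₙ|)/√|a₀ aₙ|` (`a₀ aₙ ≠ 0`), real coefficients:
`√|a₀ aₙ| ≤ max… ≤ Σ|aₖ|`, so `log R ≥ 0` in Erdős–Turán's bounds (PROVED; elementary). [cite: MilovanovicRassias2000, §5 (5.3)] -/
theorem one_le_l1_div_sqrt (q : ℝ[X]) (h0 : q.coeff 0 ≠ 0) :
    1 ≤ (∑ r ∈ Finset.range (q.natDegree + 1), |q.coeff r|) / Real.sqrt |q.coeff 0 * q.leadingCoeff| := by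
  set L := ∑ r ∈ Finset.range (q.natDegree + 1), |q.coeff r| with hL
  have abs_coeff_zero_le : |q.coeff 0| ≤ L :=
    Finset.single_le_sum (f := fun r => |q.coeff r|) (fun _ _ => abs_nonneg _)
      (Finset.mem_range.2 (Nat.succ_pos _))
  have abs_leadingCoeff_le : |q.leadingCoeff| ≤ L :=
    Finset.single_le_sum (f := fun r => |q.coeff r|) (fun _ _ => abs_nonneg _)
      (Finset.mem_range.2 (Nat.lt_succ_self _))
  have hq : q ≠ 0 := fun h => h0 (by rw [h, coeff_zero])
  have hlc : q.leadingCoeff ≠ 0 := leadingCoeff_ne_zero.2 hq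
  have hprod : 0 < |q.coeff 0 * q.leadingCoeff| := abs_pos.2 (mul_ne_zero h0 hlc)
  have hsqrt_pos : 0 < Real.sqrt |q.coeff 0 * q.leadingCoeff| := Real.sqrt_pos.2 hprod
  have hL0 : 0 ≤ L := (abs_nonneg _).trans abs_coeff_zero_le
  have hle : Real.sqrt |q.coeff 0 * q.leadingCoeff| ≤ L := by
    rw [abs_mul, ← Real.sqrt_sq hL0, sq]
    exact Real.sqrt_le_sqrt (mul_le_mul abs_coeff_zero_le abs_leadingCoeff_le (abs_nonneg _) hL0)
  rwa [le_div_iff₀ hsqrt_pos, one_mul]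

/-- **Real-coefficient form of Erdős–Turán's positive-zeros theorem** (PROVED from the named fact by complexification): for
`q : ℝ[X]` with `q(0) ≠ 0`, the number `p` of positive roots counted with multiplicity satisfies
`p² ≤ 2 · natDegree q · log(Σ_{r ≤ n} |coeff r| / √|q(0) · lc q|)`.  The positive roots of `q` map injectively (with
multiplicity: `Polynomial.map_roots_le`) to the roots of `q.map Complex.ofReal` on the positive real axis, and the coefficient
data (`natDegree`, `Σ‖aₖ‖`, `‖a₀ aₙ‖`) are unchanged. [cite: MilovanovicRassias2000, §5 Theorem 5.1] -/
theorem ErdosTuran1950_positiveZeros.real (h : ErdosTuran1950_positiveZeros) :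
    ∀ q : ℝ[X], q.coeff 0 ≠ 0 →
      ((Multiset.card (q.roots.filter (0 < ·)) : ℕ) : ℝ) ^ 2
        ≤ 2 * q.natDegree *
          Real.log ((∑ r ∈ Finset.range (q.natDegree + 1), |q.coeff r|) / Real.sqrt |q.coeff 0 * q.leadingCoeff|) := by
  intro q h0
  have hq : q ≠ 0 := fun h => h0 (by rw [h, coeff_zero])
  set Q : ℂ[X] := q.map Complex.ofRealHom with hQ
  have hinj : Function.Injective Complex.ofRealHom := Complex.ofRealHom.injective
  have hcoeff : ∀ r, Q.coeff r = (q.coeff r : ℂ) := fun r => by rw [hQ, coeff_map]; rfl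
  have hQ0 : Q.coeff 0 ≠ 0 := by rw [hcoeff]; exact_mod_cast h0
  have hdeg : Q.natDegree = q.natDegree := natDegree_map_eq_of_injective hinj q
  have hlc : Q.leadingCoeff = (q.leadingCoeff : ℂ) := by
    rw [hQ, leadingCoeff_map_of_injective hinj]; rfl
  have hQne : Q ≠ 0 := (Polynomial.map_ne_zero_iff hinj).2 hq
  -- the fact for the complexification
  have h1 := h Q hQ0
  -- coefficient data agree
  have hsum : (∑ r ∈ Finset.range (Q.natDegree + 1), ‖Q.coeff r‖) = ∑ r ∈ Finset.range (q.natDegree + 1), |q.coeff r| := by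
    rw [hdeg]
    exact Finset.sum_congr rfl fun r _ => by rw [hcoeff, Complex.norm_real, Real.norm_eq_abs]
  have hprod : ‖Q.coeff 0 * Q.leadingCoeff‖ = |q.coeff 0 * q.leadingCoeff| := by
    rw [hcoeff, hlc, ← Complex.ofReal_mul, Complex.norm_real, Real.norm_eq_abs]
  rw [hsum, hprod, hdeg] at h1
  -- the real positive roots embed into the complex roots on the positive real axis
  have hcard : Multiset.card (q.roots.filter (0 < ·)) ≤
      Multiset.card (Q.roots.filter (fun z => z.im = 0 ∧ 0 < z.re)) := by
    have hle : q.roots.map Complex.ofRealHom ≤ Q.roots := map_roots_le hQne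
    have hfilt := Multiset.filter_le_filter (fun z : ℂ => z.im = 0 ∧ 0 < z.re) hle
    rw [Multiset.filter_map] at hfilt
    have hmap := Multiset.card_le_card hfilt
    rw [Multiset.card_map] at hmap
    refine le_trans (le_of_eq ?_) hmap
    congr 1
    refine Multiset.filter_congr fun x _ => ?_
    simp [Function.comp]
  have hcardR : ((Multiset.card (q.roots.filter (0 < ·)) : ℕ) : ℝ) ≤
      ((Multiset.card (Q.roots.filter (fun z => z.im = 0 ∧ 0 < z.re)) : ℕ) : ℝ) := by exact_mod_cast hcard
  exact (pow_le_pow_left₀ (Nat.cast_nonneg _) hcardR 2).trans h1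

/-- **The consumer's form** (token-for-token the binder `hET` of
`Summit.….Theorems.LacunarySymmetroidMatrixDescartes.RangeObligations.violator_degree`, with its `l1 q` unfolded): the number
`Z₊` of DISTINCT positive roots of a real polynomial `q` with `q(0) ≠ 0` satisfies `Z₊² ≤ 256 · deg q · log(‖q‖₁/√|a₀ aₙ|)`.
PROVED from the named fact: `Z₊ ≤ p` (distinct ≤ with multiplicity), `2 ≤ 256`, `log R ≥ 0` (`one_le_l1_div_sqrt`).  The
constant `256 = 16²` is the square of the angular-discrepancy constant of the same paper (survey Theorem 5.3), which the
line's author used; Theorem 5.1 is sharper. [cite: MilovanovicRassias2000, §5 Theorems 5.1, 5.3] -/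
theorem ErdosTuran1950_positiveZeros.positiveAxis (h : ErdosTuran1950_positiveZeros) :
    ∀ q : ℝ[X], q.coeff 0 ≠ 0 →
      (((q.roots.filter (0 < ·)).toFinset.card : ℕ) : ℝ) ^ 2
        ≤ 256 * q.natDegree *
          Real.log ((∑ r ∈ Finset.range (q.natDegree + 1), |q.coeff r|) / Real.sqrt |q.coeff 0 * q.leadingCoeff|) := by
  intro q h0
  have h1 := h.real q h0
  set X := (∑ r ∈ Finset.range (q.natDegree + 1), |q.coeff r|) / Real.sqrt |q.coeff 0 * q.leadingCoeff| with hX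
  have hlog : 0 ≤ Real.log X := Real.log_nonneg (one_le_l1_div_sqrt q h0)
  have hcard : (((q.roots.filter (0 < ·)).toFinset.card : ℕ) : ℝ) ≤ ((Multiset.card (q.roots.filter (0 < ·)) : ℕ) : ℝ) := by
    exact_mod_cast Multiset.toFinset_card_le _
  have hsq : (((q.roots.filter (0 < ·)).toFinset.card : ℕ) : ℝ) ^ 2 ≤
      ((Multiset.card (q.roots.filter (0 < ·)) : ℕ) : ℝ) ^ 2 :=
    pow_le_pow_left₀ (Nat.cast_nonneg _) hcard 2
  have hn : (0 : ℝ) ≤ q.natDegree := Nat.cast_nonneg _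
  calc _ ≤ ((Multiset.card (q.roots.filter (0 < ·)) : ℕ) : ℝ) ^ 2 := hsq
    _ ≤ 2 * q.natDegree * Real.log X := h1
    _ ≤ 256 * q.natDegree * Real.log X := by nlinarith [mul_nonneg hn hlog]

end Literature.Algebra.Polynomial

end
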